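import Literature.NumberTheory.Irrationality.KrattenthalerRivoal2007.TheoremeOneClauseTwo
import HarnessLib

/-!
# Proposition 7 reduced to an integrality statement: `2·Σ_{j≥k} R_n(ε−j)ε^A(−1)^{Aj} = (k−2ε)·gTail(ε)`

[KrattenthalerRivoal2007, §13, proof of Proposition 7]: "`Σ_{j=k}^{n} T_{n,A,B,r}(j;ε)` est égal au membre de gauche de
(eq:dernier) [Corollaire 1 for general `k`] multiplié par `(rn)!^{2B}/n!^{2rB}`", the right-hand side being
`−(k−ε)/2 × (multiple sum)`; then "il faut multiplier l'expression par `2d_n^{A−e}/k`": by Leibniz on the factor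
`(k−ε)/2 · 2/k = 1 − ε/k` the claim `2 d_n^{A−e} q_{k,n,e} ∈ k·ℤ` follows from the `d_n`-integrality of the Taylor
coefficients of the (normalised) multiple sum and `k ∣ d_n`.

In the tree's normal form (Corollaire 1 for general `k` = `vwpSum_corOneParamsK`, odd `A` = `linkVwpSum_corTwoParamsK`,
Andrews = `BaileyChain.andrews`/`andrews_link`, telescoping `multiSum_eq_reduced`: at `a = −N+k−2ε` the very-well-poised
factor is `a(1+a)_{2N} = (a)_N · (k−2ε) · (1+k−2ε)_N`, so KR's `(k−ε)/2` is the tree's `(k−2ε)`), this file proves: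

* `gTailEven k N M B r ε`, `gTailOdd k N M B r ε` — the normalised tail multiple sums (`n = k+N`):
  `((−1)^{rn})^B (−1)^{N(B+1)+1} n!^A ((1−ε)_{rn}(1+ε)_{rn})^B ((1+ε+N)_k)^{A+B} ((rn+1−ε)_k)^B ·
   reducedMultiSum(−N+k−2ε)(corOneParamsK)(N) / (((1−ε)_n(1+ε)_n)^{A+B} n!^{2Br} N!)` (odd: `linkReducedMultiSum`,
  `corTwoParamsK`, `A = 2M+3`);
* **`two_mul_sum_regR_tail_even/odd`** — for `0 < |ε| < 1/2`:
  `2 · Σ_{j=k}^{n} ((−1)^A)^j R_n(ε−j) ε^A = (k − 2ε) · gTail(ε)`;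
* **`prop7_even_of_isDInt`**, **`prop7_odd_of_isDInt`** — if `gTail` is `IsDInt (d_n)` at `0` to all orders, then for all
  partial-fraction data `c` of `R_{n,A,B,r}` and `1 ≤ e ≤ A`: `2 d_n^{A−e} · tailCoeffSum n A c e k ∈ k·ℤ` — the
  conclusion of KR's Proposition 7 (`𝒟_m((k−2ε)g) = k𝒟_m g − 2𝒟_{m−1} g`, `k ∣ d_n`);
* **`theoreme1_of_gTail_isDInt`** — hence the named fact `theoreme1` follows from the two integrality statements
  `∀ k N M B r N', 1 ≤ k → 1 ≤ B → IsDInt (d_{k+N}) N' (gTailEven k N M B r) 0` (and odd), via `theoreme1_of_prop7` and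
  the PROVED clause (i).

What remains for `theoreme1_holds` is exactly KR's brick decomposition (eq:dernier)/(§13 (eq:briques)) of these two
functions (elementary bricks, `R₁(n,n−k−i_j,n−i_j+i_{j−1};ε)`, `R₇ = ε·R₃` with Lemme 11 = `specialBrickR3_isDInt`),
i.e. the general-`k` analogue of `proposition6_even'`/`proposition6_odd'`; it is NOT done here and no named fact is
introduced for it. Exact-arithmetic replay of the identities and of the integrality (Taylor orders ≤ 7, random
parameters): custody `tools/check_prop7_tail.py`.

## References
* [KrattenthalerRivoal2007] §13 Proposition 7 and its proof; §9 Corollaires 1–2 (arXiv:math/0311114 pp. 21, 30–31).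
-/

open Finset Filter Topology
open scoped Nat
open Literature.Analysis.Calculus
open Literature.NumberTheory.Transcendental
open Literature.Combinatorics.Enumerative.BaileyChain

namespace Literature.NumberTheory.Irrationality.KrattenthalerRivoal2007

/-! ### The normalised tail multiple sums -/

/-- The normalised tail multiple sum for even `A = 2M+2` (`n = k+N`, chain `corOneParamsK`, `a = −N+k−2ε`):
`gTailEven = ((−1)^{rn})^B (−1)^{N(B+1)+1} n!^A ((1−ε)_{rn}(1+ε)_{rn})^B ((1+ε+N)_k)^{A+B} ((rn+1−ε)_k)^B ·
reducedMultiSum a (corOneParamsK ε N k M B r) N / (((1−ε)_n(1+ε)_n)^{A+B} n!^{2Br} N!)`.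
[cite: KrattenthalerRivoal2007, §13 proof of Proposition 7 ((eq:dernier) × (rn)!^{2B}/n!^{2rB}), A even] -/
def gTailEven (k N M B r : ℕ) (ε : ℚ) : ℚ :=
  ((-1 : ℚ) ^ (r * (k + N))) ^ B * (-1) ^ (N * (B + 1) + 1) *
    (((k + N)! : ℚ) ^ (2 * M + 2) *
      ((∏ l ∈ range (r * (k + N)), (1 - ε + (l : ℚ))) * ∏ l ∈ range (r * (k + N)), (1 + ε + (l : ℚ))) ^ B *
      (∏ i ∈ range k, (1 + ε + (N : ℚ) + i)) ^ (2 * M + 2 + B) *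
      (∏ i ∈ range k, (((r * (k + N) : ℕ) : ℚ) + 1 - ε + i)) ^ B /
      ((((∏ l ∈ range (k + N), (1 - ε + (l : ℚ))) * ∏ l ∈ range (k + N), (1 + ε + (l : ℚ))) ^ (2 * M + 2 + B)) *
        ((k + N)! : ℚ) ^ (2 * B * r) * (N ! : ℚ))) *
    reducedMultiSum (-(N : ℚ) + k - 2 * ε) (corOneParamsK ε N k M B r) N

/-- The normalised tail multiple sum for odd `A = 2M+3` (link chain `corTwoParamsK`).
[cite: KrattenthalerRivoal2007, §13 proof of Proposition 7 («le cas que A est impair … Corollaire 2»), A odd] -/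
def gTailOdd (k N M B r : ℕ) (ε : ℚ) : ℚ :=
  ((-1 : ℚ) ^ (r * (k + N))) ^ B * (-1) ^ (N * (B + 1) + 1) *
    (((k + N)! : ℚ) ^ (2 * M + 3) *
      ((∏ l ∈ range (r * (k + N)), (1 - ε + (l : ℚ))) * ∏ l ∈ range (r * (k + N)), (1 + ε + (l : ℚ))) ^ B *
      (∏ i ∈ range k, (1 + ε + (N : ℚ) + i)) ^ (2 * M + 3 + B) *
      (∏ i ∈ range k, (((r * (k + N) : ℕ) : ℚ) + 1 - ε + i)) ^ B /
      ((((∏ l ∈ range (k + N), (1 - ε + (l : ℚ))) * ∏ l ∈ range (k + N), (1 + ε + (l : ℚ))) ^ (2 * M + 3 + B)) *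
        ((k + N)! : ℚ) ^ (2 * B * r) * (N ! : ℚ))) *
    linkReducedMultiSum (-(N : ℚ) + k - 2 * ε) (corTwoParamsK ε N k M B r) N

/-! ### Auxiliary facts near `ε = 0` -/

/-- For `|ε| < 1/2`, `ε` is off every pole of every `regR_j`. [folklore] -/
private theorem offPoles'' {ε : ℚ} (h1 : ε < 1 / 2) (h2 : -(1 / 2) < ε) (n j : ℕ) :
    ∀ q ∈ (range (n + 1)).erase j, ε - j + q ≠ 0 := by
  intro q hq h
  have hqj : q ≠ j := (mem_erase.1 hq).1
  rcases lt_or_gt_of_ne hqj with hlt | hgt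
  · have : (q : ℚ) + 1 ≤ j := by exact_mod_cast hlt
    linarith
  · have : (j : ℚ) + 1 ≤ q := by exact_mod_cast hgt
    linarith

/-- `(1∓ε)_m ≠ 0` for `|ε| < 1/2`. [folklore] -/
private theorem prod_pm_ne_zero'' {ε : ℚ} (h1 : ε < 1 / 2) (h2 : -(1 / 2) < ε) (m : ℕ) :
    (∏ l ∈ range m, (1 - ε + (l : ℚ))) ≠ 0 ∧ (∏ l ∈ range m, (1 + ε + (l : ℚ))) ≠ 0 := by
  refine ⟨prod_ne_zero_iff.2 fun l _ => ?_, prod_ne_zero_iff.2 fun l _ => ?_⟩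
  · have : (0 : ℚ) ≤ l := Nat.cast_nonneg l
    exact ne_of_gt (by linarith)
  · have : (0 : ℚ) ≤ l := Nat.cast_nonneg l
    exact ne_of_gt (by linarith)

/-- `(1+ε+N)_k ≠ 0`, `(rn+1−ε)_k ≠ 0`, `(1+k−2ε)_N ≠ 0` for `|ε| < 1/2`, and `(−N+k−2ε)_N ≠ 0` for `0 < |ε| < 1/2`. [folklore] -/
private theorem chain_ne_zero {ε : ℚ} (h1 : ε < 1 / 2) (h2 : -(1 / 2) < ε) (h0 : ε ≠ 0) (k N rn : ℕ) :
    (∏ i ∈ range k, (1 + ε + (N : ℚ) + i)) ≠ 0 ∧ (∏ i ∈ range k, ((rn : ℚ) + 1 - ε + i)) ≠ 0 ∧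
      (∏ i ∈ range N, (1 + (k : ℚ) - 2 * ε + i)) ≠ 0 ∧ (∏ i ∈ range N, (-(N : ℚ) + k - 2 * ε + i)) ≠ 0 := by
  refine ⟨prod_ne_zero_iff.2 fun i _ => ?_, prod_ne_zero_iff.2 fun i _ => ?_, prod_ne_zero_iff.2 fun i _ => ?_,
    prod_ne_zero_iff.2 fun i _ => ?_⟩
  · have : (0 : ℚ) ≤ i := Nat.cast_nonneg i
    have : (0 : ℚ) ≤ N := Nat.cast_nonneg N
    exact ne_of_gt (by linarith)
  · have : (0 : ℚ) ≤ i := Nat.cast_nonneg i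
    have : (0 : ℚ) ≤ rn := Nat.cast_nonneg rn
    exact ne_of_gt (by linarith)
  · have : (0 : ℚ) ≤ i := Nat.cast_nonneg i
    have : (0 : ℚ) ≤ k := Nat.cast_nonneg k
    exact ne_of_gt (by linarith)
  · -- `−N+k+i−2ε = 0` would make `2ε` a nonzero integer of absolute value `< 1`
    intro h
    rcases lt_trichotomy (k + i) N with hlt | heq | hgt
    · have : ((k : ℚ) + i) + 1 ≤ N := by exact_mod_cast hlt
      linarith
    · have : ((k : ℚ) + i) = N := by exact_mod_cast heq
      exact h0 (by linarith)
    · have : (N : ℚ) + 1 ≤ (k : ℚ) + i := by exact_mod_cast hgt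
      linarith

/-- Off a point, continuity plus agreement on a punctured neighbourhood gives agreement of germs. [folklore] -/
private theorem eventuallyEq_of_punctured {f g : ℚ → ℚ} {x : ℚ} (hf : ContinuousAt f x)
    (hg : ContinuousAt g x) (h : ∀ᶠ t : ℚ in 𝓝[≠] x, f t = g t) : f =ᶠ[𝓝 x] g := by
  have hx : f x = g x := by
    have hf' : Tendsto f (𝓝[≠] x) (𝓝 (f x)) := hf.tendsto.mono_left nhdsWithin_le_nhds
    have hg' : Tendsto g (𝓝[≠] x) (𝓝 (g x)) := hg.tendsto.mono_left nhdsWithin_le_nhds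
    exact tendsto_nhds_unique (hf'.congr' h) hg'
  rw [eventually_nhdsWithin_iff] at h
  filter_upwards [h] with t ht
  by_cases htx : t = x
  · rw [htx, hx]
  · exact ht htx

/-- The telescoped very-well-poised factor at `a = −N+k−2ε`: `a (1+a)_{2N} = (a)_N · (k−2ε) · (1+k−2ε)_N`.
[cite: KrattenthalerRivoal2007, §9 proof of Corollaire 1 (the factor −(k−ε)/2)] -/
theorem vwpFactor_tail (ε : ℚ) (k N : ℕ) :
    (-(N : ℚ) + k - 2 * ε) * ∏ j ∈ range (2 * N), (1 + (-(N : ℚ) + k - 2 * ε) + j) =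
      (∏ i ∈ range N, (-(N : ℚ) + k - 2 * ε + i)) * ((k : ℚ) - 2 * ε) *
        ∏ i ∈ range N, (1 + (k : ℚ) - 2 * ε + i) := by
  have h : ∀ (z : ℚ) (m : ℕ), z * ∏ j ∈ range (2 * m), (1 + z + j) =
      (∏ i ∈ range m, (z + i)) * (z + m) * ∏ i ∈ range m, (z + m + 1 + i) := by
    intro z m
    have e1 : z * ∏ j ∈ range (2 * m), (1 + z + j) = ∏ j ∈ range (2 * m + 1), (z + j) := by
      rw [prod_range_succ', mul_comm]
      congr 1
      · exact prod_congr rfl fun j _ => by push_cast; ring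
      · simp
    have e2 : ∏ j ∈ range (2 * m + 1), (z + j) = (∏ i ∈ range m, (z + i)) * ∏ i ∈ range (m + 1), (z + m + i) := by
      rw [show 2 * m + 1 = m + (m + 1) by ring, prod_range_add]
      congr 1
      exact prod_congr rfl fun i _ => by push_cast; ring
    rw [e1, e2, prod_range_succ', mul_comm (∏ i ∈ range m, (z + m + ((i + 1 : ℕ) : ℚ))) _, ← mul_assoc]
    congr 1
    · simp
    · exact prod_congr rfl fun i _ => by push_cast; ring
  rw [h]
  congr 1
  · congr 1
    ring
  · exact prod_congr rfl fun i _ => by ring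

/-! ### The tail dictionary -/

/-- **`regR_dictionary` summed over `j ≥ k`**: off the poles,
`(Σ_{j=k}^{n} ((−1)^A)^j regR_j(ε)) · 2((1−ε)_n(1+ε)_n)^{A+B} · n!^{2Br}
   = ((−1)^{rn})^B n!^A ((1−ε)_{rn}(1+ε)_{rn})^B · wpTaylorTailSum ε n A B r k`.
[cite: KrattenthalerRivoal2007, §13 proof of Proposition 7 («Σ_{j=k}^{n} T(j;ε) est égal au membre de gauche de (eq:dernier)…»)] -/
theorem sum_regR_tail_dictionary (n A B r k : ℕ) {ε : ℚ}
    (hε : ∀ j ≤ n, ∀ q ∈ (range (n + 1)).erase j, ε - j + q ≠ 0) :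
    (∑ j ∈ Ico k (n + 1), ((-1 : ℚ) ^ A) ^ j * regR n A B r j ε) *
        (2 * ((∏ i ∈ range n, (1 - ε + i)) * ∏ i ∈ range n, (1 + ε + i)) ^ (A + B)) *
          (n ! : ℚ) ^ (2 * B * r) =
      ((-1 : ℚ) ^ (r * n)) ^ B * (n ! : ℚ) ^ A *
        ((∏ i ∈ range (r * n), (1 - ε + i)) * ∏ i ∈ range (r * n), (1 + ε + i)) ^ B *
          wpTaylorTailSum ε n A B r k := by
  rw [wpTaylorTailSum, mul_sum, sum_mul, sum_mul]
  refine sum_congr rfl fun j hj => ?_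
  have hjn : j ≤ n := Nat.lt_succ_iff.mp (mem_Ico.mp hj).2
  linear_combination regR_dictionary n A B r j hjn (hε j hjn)

/-! ### `2·Σ_{j≥k} = (k−2ε)·gTail`, even `A` -/

/-- **Even `A = 2M+2`**: for `0 < |ε| < 1/2` and `n = k+N`,
`2 · Σ_{j=k}^{n} ((−1)^A)^j R_n(ε−j)ε^A = (k − 2ε) · gTailEven k N M B r ε`
(`sum_regR_tail_dictionary`, Corollaire 1 for general `k` = `vwpSum_corOneParamsK`, Andrews, `multiSum_eq_reduced`,
`vwpFactor_tail`). [cite: KrattenthalerRivoal2007, §13 proof of Proposition 7, (eq:dernier), A even] -/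
theorem two_mul_sum_regR_tail_even (k N M B r : ℕ) {ε : ℚ} (h1 : ε < 1 / 2) (h2 : -(1 / 2) < ε) (h0 : ε ≠ 0) :
    2 * ∑ j ∈ Ico k (k + N + 1), ((-1 : ℚ) ^ (2 * M + 2)) ^ j * regR (k + N) (2 * M + 2) B r j ε =
      ((k : ℚ) - 2 * ε) * gTailEven k N M B r ε := by
  unfold gTailEven
  set n := k + N with hn
  have hD := sum_regR_tail_dictionary n (2 * M + 2) B r k (ε := ε) fun j _ => offPoles'' h1 h2 n j
  have hC := vwpSum_corOneParamsK ε N k M B r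
  rw [andrews, multiSum_eq_reduced, ← hn] at hC
  obtain ⟨hDm, hDp⟩ := prod_pm_ne_zero'' h1 h2 n
  obtain ⟨hP, hQ, h1k, haN⟩ := chain_ne_zero h1 h2 h0 k N (r * n)
  set S := ∑ j ∈ Ico k (n + 1), ((-1 : ℚ) ^ (2 * M + 2)) ^ j * regR n (2 * M + 2) B r j ε
  set W := wpTaylorTailSum ε n (2 * M + 2) B r k
  set Dm := ∏ i ∈ range n, (1 - ε + (i : ℚ))
  set Dp := ∏ i ∈ range n, (1 + ε + (i : ℚ))
  set Rm := ∏ i ∈ range (r * n), (1 - ε + (i : ℚ))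
  set Rp := ∏ i ∈ range (r * n), (1 + ε + (i : ℚ))
  set P := ∏ i ∈ range k, (1 + ε + (N : ℚ) + i)
  set Q := ∏ i ∈ range k, (((r * n : ℕ) : ℚ) + 1 - ε + i)
  set aN := ∏ i ∈ range N, (-(N : ℚ) + k - 2 * ε + i)
  set kN := ∏ i ∈ range N, (1 + (k : ℚ) - 2 * ε + i)
  set red := reducedMultiSum (-(N : ℚ) + k - 2 * ε) (corOneParamsK ε N k M B r) N
  -- Corollaire 1 (general k) with the telescoped factor, `(a)_N (1+k−2ε)_N` cancelled
  have hC' : P ^ (2 * M + 2 + B) * Q ^ B * (((k : ℚ) - 2 * ε) * red) =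
      (-1 : ℚ) ^ (N * (B + 1) + 1) * (N ! : ℚ) * W := by
    have e : P ^ (2 * M + 2 + B) * Q ^ B * ((-(N : ℚ) + k - 2 * ε) *
        (∏ j ∈ range (2 * N), (1 + (-(N : ℚ) + k - 2 * ε) + j)) * red) =
        (-1 : ℚ) ^ (N * (B + 1) + 1) * (N ! : ℚ) * aN * kN * W := hC
    rw [vwpFactor_tail] at e
    apply mul_left_cancel₀ (mul_ne_zero haN h1k)
    linear_combination e
  have hn0 : (n ! : ℚ) ≠ 0 := by positivity
  have hN0 : (N ! : ℚ) ≠ 0 := by positivity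
  have hK : (2 * (Dm * Dp) ^ (2 * M + 2 + B)) * (n ! : ℚ) ^ (2 * B * r) ≠ 0 := by
    have := mul_ne_zero hDm hDp
    positivity
  have hs2 : ((-1 : ℚ) ^ (N * (B + 1) + 1)) ^ 2 = 1 := by
    rw [← pow_mul]
    exact Even.neg_one_pow ⟨N * (B + 1) + 1, by ring⟩
  have eg : (N ! : ℚ) * (((k : ℚ) - 2 * ε) * (((-1 : ℚ) ^ (r * n)) ^ B * (-1) ^ (N * (B + 1) + 1) *
      ((n ! : ℚ) ^ (2 * M + 2) * (Rm * Rp) ^ B * P ^ (2 * M + 2 + B) * Q ^ B /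
        ((Dm * Dp) ^ (2 * M + 2 + B) * (n ! : ℚ) ^ (2 * B * r) * (N ! : ℚ))) * red) *
      ((2 * (Dm * Dp) ^ (2 * M + 2 + B)) * (n ! : ℚ) ^ (2 * B * r))) =
      2 * ((-1 : ℚ) ^ (r * n)) ^ B * (-1) ^ (N * (B + 1) + 1) * (n ! : ℚ) ^ (2 * M + 2) * (Rm * Rp) ^ B *
        (P ^ (2 * M + 2 + B) * Q ^ B * (((k : ℚ) - 2 * ε) * red)) := by
    field_simp
  rw [hC'] at eg
  apply mul_right_cancel₀ hK
  apply mul_left_cancel₀ hN0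
  linear_combination (-1 : ℚ) * eg + 2 * (N ! : ℚ) * hD -
    2 * ((-1 : ℚ) ^ (r * n)) ^ B * (n ! : ℚ) ^ (2 * M + 2) * (Rm * Rp) ^ B * (N ! : ℚ) * W * hs2

/-- **Odd `A = 2M+3`**: for `0 < |ε| < 1/2` and `n = k+N`,
`2 · Σ_{j=k}^{n} ((−1)^A)^j R_n(ε−j)ε^A = (k − 2ε) · gTailOdd k N M B r ε` (Corollaire 2 for general `k`).
[cite: KrattenthalerRivoal2007, §13 proof of Proposition 7 («Corollaire 2 au lieu du Corollaire 1»), A odd] -/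
theorem two_mul_sum_regR_tail_odd (k N M B r : ℕ) {ε : ℚ} (h1 : ε < 1 / 2) (h2 : -(1 / 2) < ε) (h0 : ε ≠ 0) :
    2 * ∑ j ∈ Ico k (k + N + 1), ((-1 : ℚ) ^ (2 * M + 3)) ^ j * regR (k + N) (2 * M + 3) B r j ε =
      ((k : ℚ) - 2 * ε) * gTailOdd k N M B r ε := by
  unfold gTailOdd
  set n := k + N with hn
  have hD := sum_regR_tail_dictionary n (2 * M + 3) B r k (ε := ε) fun j _ => offPoles'' h1 h2 n j
  have hC := linkVwpSum_corTwoParamsK ε N k M B r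
  rw [andrews_link, linkMultiSum_eq_reduced, ← hn] at hC
  obtain ⟨hDm, hDp⟩ := prod_pm_ne_zero'' h1 h2 n
  obtain ⟨hP, hQ, h1k, haN⟩ := chain_ne_zero h1 h2 h0 k N (r * n)
  set S := ∑ j ∈ Ico k (n + 1), ((-1 : ℚ) ^ (2 * M + 3)) ^ j * regR n (2 * M + 3) B r j ε
  set W := wpTaylorTailSum ε n (2 * M + 3) B r k
  set Dm := ∏ i ∈ range n, (1 - ε + (i : ℚ))
  set Dp := ∏ i ∈ range n, (1 + ε + (i : ℚ))
  set Rm := ∏ i ∈ range (r * n), (1 - ε + (i : ℚ))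
  set Rp := ∏ i ∈ range (r * n), (1 + ε + (i : ℚ))
  set P := ∏ i ∈ range k, (1 + ε + (N : ℚ) + i)
  set Q := ∏ i ∈ range k, (((r * n : ℕ) : ℚ) + 1 - ε + i)
  set aN := ∏ i ∈ range N, (-(N : ℚ) + k - 2 * ε + i)
  set kN := ∏ i ∈ range N, (1 + (k : ℚ) - 2 * ε + i)
  set red := linkReducedMultiSum (-(N : ℚ) + k - 2 * ε) (corTwoParamsK ε N k M B r) N
  have hC' : P ^ (2 * M + 3 + B) * Q ^ B * (((k : ℚ) - 2 * ε) * red) =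
      (-1 : ℚ) ^ (N * (B + 1) + 1) * (N ! : ℚ) * W := by
    have e : P ^ (2 * M + 3 + B) * Q ^ B * ((-(N : ℚ) + k - 2 * ε) *
        (∏ j ∈ range (2 * N), (1 + (-(N : ℚ) + k - 2 * ε) + j)) * red) =
        (-1 : ℚ) ^ (N * (B + 1) + 1) * (N ! : ℚ) * aN * kN * W := hC
    rw [vwpFactor_tail] at e
    apply mul_left_cancel₀ (mul_ne_zero haN h1k)
    linear_combination e
  have hn0 : (n ! : ℚ) ≠ 0 := by positivity
  have hN0 : (N ! : ℚ) ≠ 0 := by positivity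
  have hK : (2 * (Dm * Dp) ^ (2 * M + 3 + B)) * (n ! : ℚ) ^ (2 * B * r) ≠ 0 := by
    have := mul_ne_zero hDm hDp
    positivity
  have hs2 : ((-1 : ℚ) ^ (N * (B + 1) + 1)) ^ 2 = 1 := by
    rw [← pow_mul]
    exact Even.neg_one_pow ⟨N * (B + 1) + 1, by ring⟩
  have eg : (N ! : ℚ) * (((k : ℚ) - 2 * ε) * (((-1 : ℚ) ^ (r * n)) ^ B * (-1) ^ (N * (B + 1) + 1) *
      ((n ! : ℚ) ^ (2 * M + 3) * (Rm * Rp) ^ B * P ^ (2 * M + 3 + B) * Q ^ B /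
        ((Dm * Dp) ^ (2 * M + 3 + B) * (n ! : ℚ) ^ (2 * B * r) * (N ! : ℚ))) * red) *
      ((2 * (Dm * Dp) ^ (2 * M + 3 + B)) * (n ! : ℚ) ^ (2 * B * r))) =
      2 * ((-1 : ℚ) ^ (r * n)) ^ B * (-1) ^ (N * (B + 1) + 1) * (n ! : ℚ) ^ (2 * M + 3) * (Rm * Rp) ^ B *
        (P ^ (2 * M + 3 + B) * Q ^ B * (((k : ℚ) - 2 * ε) * red)) := by
    field_simp
  rw [hC'] at eg
  apply mul_right_cancel₀ hK
  apply mul_left_cancel₀ hN0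
  linear_combination (-1 : ℚ) * eg + 2 * (N ! : ℚ) * hD -
    2 * ((-1 : ℚ) ^ (r * n)) ^ B * (n ! : ℚ) ^ (2 * M + 3) * (Rm * Rp) ^ B * (N ! : ℚ) * W * hs2

/-! ### The Leibniz step: Proposition 7 from the integrality of `gTail` -/

/-- Divided derivatives of `(k − 2ε)·g` at `0`: `𝒟_m((k−2ε)g)(0) = k·𝒟_m g(0) − 2·𝒟_{m−1} g(0)` (`m ≥ 1`) and
`= k·g(0)` (`m = 0`); integrality bookkeeping with `k ∣ d`: if `g` is `IsDInt d m` at `0` then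
`d^m 𝒟_m((k−2ε)g)(0) ∈ k·ℤ + 2d·ℤ ⊆ k·ℤ`. [cite: KrattenthalerRivoal2007, §13 proof of Proposition 7 («En vertu de la
formule de Leibniz … le fait que k divise d_n»)] -/
theorem isInt_divDeriv_linear_mul {d k m : ℕ} {g : ℚ → ℚ} (hk : k ∣ d) (hg : IsDInt d m g 0) :
    ∃ z : ℤ, (d : ℚ) ^ m * divDeriv m (fun ε => ((k : ℚ) - 2 * ε) * g ε) 0 = (k : ℚ) * z := by
  have hlin : ContDiffAt ℚ m (fun ε : ℚ => (k : ℚ) - 2 * ε) 0 := by fun_prop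
  rw [divDeriv_fun_mul hlin hg.contDiffAt]
  have hcoef : ∀ i, divDeriv i (fun ε : ℚ => (k : ℚ) - 2 * ε) 0 = if i = 0 then (k : ℚ) else if i = 1 then -2 else 0 := by
    intro i
    have h := iteratedDeriv_affine (-2) (k : ℚ) 0 i
    rw [divDeriv, show (fun ε : ℚ => (k : ℚ) - 2 * ε) = fun t : ℚ => -2 * t + k from funext fun t => by ring, h]
    rcases i with _ | _ | i
    · simp
    · simp
    · simp
  simp_rw [hcoef]
  obtain ⟨c, hc⟩ := hk
  rcases m with _ | m
  · obtain ⟨z, hz⟩ := hg.isInt 0 le_rfl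
    refine ⟨z, ?_⟩
    simp only [zero_add, range_one, sum_singleton, ↓reduceIte, Nat.sub_zero, pow_zero, one_mul] at hz ⊢
    rw [hz]
  · obtain ⟨z0, hz0⟩ := hg.isInt (m + 1) le_rfl
    obtain ⟨z1, hz1⟩ := hg.isInt m (Nat.le_succ m)
    refine ⟨z0 - 2 * (c : ℤ) * z1, ?_⟩
    rw [sum_range_succ', sum_range_succ']
    have hrest : ∑ i ∈ range m, (if i + 1 + 1 = 0 then (k : ℚ) else if i + 1 + 1 = 1 then -2 else 0) *
        divDeriv (m + 1 - (i + 1 + 1)) g 0 = 0 := by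
      refine sum_eq_zero fun i _ => ?_
      rw [if_neg (by omega), if_neg (by omega), zero_mul]
    rw [hrest, zero_add]
    simp only [zero_add, one_ne_zero, ↓reduceIte, Nat.add_sub_cancel, Nat.sub_zero]
    have hd : (d : ℚ) ^ (m + 1) = (d : ℚ) ^ m * (k * c : ℕ) := by rw [← hc, pow_succ]
    push_cast
    rw [mul_add, show (d : ℚ) ^ (m + 1) * (-2 * divDeriv m g 0) = -2 * (d : ℚ) * ((d : ℚ) ^ m * divDeriv m g 0) by ring,
      hz1, ← hz0, hc]
    push_cast
    ring

/-- The tail coefficient sums are divided derivatives of the tail sum of regularised functions: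
`tailCoeffSum n A c e k = 𝒟_{A−e}(Σ_{j=k}^{n} ((−1)^A)^j regR_j)(0)`. [cite: KrattenthalerRivoal2007, §13 (definition of q_{k,n,e})] -/
theorem tailCoeffSum_eq_divDeriv {n A B r : ℕ} {c : ℕ → ℕ → ℚ} (hc : IsPartialFractionData n A B r c)
    {e : ℕ} (he1 : 1 ≤ e) (heA : e ≤ A) (k : ℕ) :
    tailCoeffSum n A c e k = divDeriv (A - e) (fun ε => ∑ j ∈ Ico k (n + 1), ((-1 : ℚ) ^ A) ^ j * regR n A B r j ε) 0 := by
  have h0 : ∀ j : ℕ, ∀ q ∈ (range (n + 1)).erase j, (0 : ℚ) - j + q ≠ 0 := fun j =>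
    offPoles'' (by norm_num) (by norm_num) n j
  have hreg : ∀ j ∈ Ico k (n + 1),
      ContDiffAt ℚ ((A - e : ℕ) : ℕ∞) (fun ε => ((-1 : ℚ) ^ A) ^ j * regR n A B r j ε) 0 :=
    fun j _ => contDiffAt_const.mul (contDiffAt_regR n A B r j (h0 j))
  rw [divDeriv_sum hreg, tailCoeffSum, ← Finset.Ico_add_one_right_eq_Icc]
  refine sum_congr rfl fun j hj => ?_
  have hjn : j ≤ n := Nat.lt_succ_iff.mp (mem_Ico.mp hj).2
  rw [divDeriv_const_mul, hc.coeff_eq_divDeriv hjn he1 heA, mul_comm]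

/-- **Proposition 7 (even `A`) from the integrality of `gTailEven`**: if `gTailEven k N M B r` is `IsDInt (d_n)` at
`0` to all orders (`n = k+N`, `k ≥ 1`), then for all partial-fraction data `c` of `R_{n,2M+2,B,r}` and `1 ≤ e ≤ A`,
`2 d_n^{A−e} · tailCoeffSum n A c e k = 2 d_n^{A−e} q_{k,n,e} ∈ k·ℤ`.
[cite: KrattenthalerRivoal2007, §13 Proposition 7 and its proof, A even] -/
theorem prop7_even_of_isDInt (k N M B r : ℕ) (hk : 1 ≤ k)
    (hg : ∀ N' : ℕ, IsDInt (Nat.lcmUpto (k + N)) N' (gTailEven k N M B r) 0)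
    (c : ℕ → ℕ → ℚ) (hc : IsPartialFractionData (k + N) (2 * M + 2) B r c) (e : ℕ) (he1 : 1 ≤ e)
    (heA : e ≤ 2 * M + 2) :
    ∃ z : ℤ, 2 * ((Nat.lcmUpto (k + N) : ℕ) : ℚ) ^ (2 * M + 2 - e) * tailCoeffSum (k + N) (2 * M + 2) c e k =
      (k : ℚ) * z := by
  set n := k + N with hn
  set m := 2 * M + 2 - e with hm
  -- `2·Σ = (k−2ε)·g` near `0` (punctured, then everywhere by continuity)
  have h0 : ∀ j : ℕ, ∀ q ∈ (range (n + 1)).erase j, (0 : ℚ) - j + q ≠ 0 := fun j =>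
    offPoles'' (by norm_num) (by norm_num) n j
  have hcont : ContinuousAt (fun ε => 2 * ∑ j ∈ Ico k (n + 1), ((-1 : ℚ) ^ (2 * M + 2)) ^ j *
      regR n (2 * M + 2) B r j ε) 0 :=
    (contDiffAt_const.mul (ContDiffAt.sum fun j _ =>
      contDiffAt_const.mul (contDiffAt_regR n (2 * M + 2) B r j (h0 j) (N := 0)))).continuousAt
  have hcont' : ContinuousAt (fun ε => ((k : ℚ) - 2 * ε) * gTailEven k N M B r ε) 0 :=
    (by fun_prop : ContinuousAt (fun ε : ℚ => (k : ℚ) - 2 * ε) 0).mul (hg 0).contDiffAt.continuousAt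
  have hev : (fun ε => 2 * ∑ j ∈ Ico k (n + 1), ((-1 : ℚ) ^ (2 * M + 2)) ^ j * regR n (2 * M + 2) B r j ε)
      =ᶠ[𝓝 (0 : ℚ)] fun ε => ((k : ℚ) - 2 * ε) * gTailEven k N M B r ε := by
    refine eventuallyEq_of_punctured hcont hcont' ?_
    have e1 : ∀ᶠ ε in 𝓝 (0 : ℚ), ε < 1 / 2 := eventually_lt_nhds (by norm_num)
    have e2 : ∀ᶠ ε in 𝓝 (0 : ℚ), -(1 / 2) < ε := eventually_gt_nhds (by norm_num)
    have e3 : ∀ᶠ ε in 𝓝[≠] (0 : ℚ), ε ≠ 0 := eventually_mem_nhdsWithin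
    filter_upwards [mem_nhdsWithin_of_mem_nhds e1, mem_nhdsWithin_of_mem_nhds e2, e3] with ε hε1 hε2 hε0
    rw [hn]
    exact two_mul_sum_regR_tail_even k N M B r hε1 hε2 hε0
  -- Taylor coefficients
  have hT := tailCoeffSum_eq_divDeriv hc he1 heA k
  have hkey : 2 * tailCoeffSum n (2 * M + 2) c e k = divDeriv m (fun ε => ((k : ℚ) - 2 * ε) * gTailEven k N M B r ε) 0 := by
    rw [hT, ← divDeriv_const_mul, divDeriv_congr hev]
  have hkd : k ∣ Nat.lcmUpto n := dvd_lcmUpto hk (by omega)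
  obtain ⟨z, hz⟩ := isInt_divDeriv_linear_mul (m := m) hkd (hg m)
  refine ⟨z, ?_⟩
  rw [← hz, mul_comm (2 : ℚ), mul_assoc, hkey]

/-- **Proposition 7 (odd `A`) from the integrality of `gTailOdd`**. [cite: KrattenthalerRivoal2007, §13 Proposition 7 and its proof, A odd] -/
theorem prop7_odd_of_isDInt (k N M B r : ℕ) (hk : 1 ≤ k)
    (hg : ∀ N' : ℕ, IsDInt (Nat.lcmUpto (k + N)) N' (gTailOdd k N M B r) 0)
    (c : ℕ → ℕ → ℚ) (hc : IsPartialFractionData (k + N) (2 * M + 3) B r c) (e : ℕ) (he1 : 1 ≤ e)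
    (heA : e ≤ 2 * M + 3) :
    ∃ z : ℤ, 2 * ((Nat.lcmUpto (k + N) : ℕ) : ℚ) ^ (2 * M + 3 - e) * tailCoeffSum (k + N) (2 * M + 3) c e k =
      (k : ℚ) * z := by
  set n := k + N with hn
  set m := 2 * M + 3 - e with hm
  have h0 : ∀ j : ℕ, ∀ q ∈ (range (n + 1)).erase j, (0 : ℚ) - j + q ≠ 0 := fun j =>
    offPoles'' (by norm_num) (by norm_num) n j
  have hcont : ContinuousAt (fun ε => 2 * ∑ j ∈ Ico k (n + 1), ((-1 : ℚ) ^ (2 * M + 3)) ^ j *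
      regR n (2 * M + 3) B r j ε) 0 :=
    (contDiffAt_const.mul (ContDiffAt.sum fun j _ =>
      contDiffAt_const.mul (contDiffAt_regR n (2 * M + 3) B r j (h0 j) (N := 0)))).continuousAt
  have hcont' : ContinuousAt (fun ε => ((k : ℚ) - 2 * ε) * gTailOdd k N M B r ε) 0 :=
    (by fun_prop : ContinuousAt (fun ε : ℚ => (k : ℚ) - 2 * ε) 0).mul (hg 0).contDiffAt.continuousAt
  have hev : (fun ε => 2 * ∑ j ∈ Ico k (n + 1), ((-1 : ℚ) ^ (2 * M + 3)) ^ j * regR n (2 * M + 3) B r j ε)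
      =ᶠ[𝓝 (0 : ℚ)] fun ε => ((k : ℚ) - 2 * ε) * gTailOdd k N M B r ε := by
    refine eventuallyEq_of_punctured hcont hcont' ?_
    have e1 : ∀ᶠ ε in 𝓝 (0 : ℚ), ε < 1 / 2 := eventually_lt_nhds (by norm_num)
    have e2 : ∀ᶠ ε in 𝓝 (0 : ℚ), -(1 / 2) < ε := eventually_gt_nhds (by norm_num)
    have e3 : ∀ᶠ ε in 𝓝[≠] (0 : ℚ), ε ≠ 0 := eventually_mem_nhdsWithin
    filter_upwards [mem_nhdsWithin_of_mem_nhds e1, mem_nhdsWithin_of_mem_nhds e2, e3] with ε hε1 hε2 hε0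
    rw [hn]
    exact two_mul_sum_regR_tail_odd k N M B r hε1 hε2 hε0
  have hT := tailCoeffSum_eq_divDeriv hc he1 heA k
  have hkey : 2 * tailCoeffSum n (2 * M + 3) c e k = divDeriv m (fun ε => ((k : ℚ) - 2 * ε) * gTailOdd k N M B r ε) 0 := by
    rw [hT, ← divDeriv_const_mul, divDeriv_congr hev]
  have hkd : k ∣ Nat.lcmUpto n := dvd_lcmUpto hk (by omega)
  obtain ⟨z, hz⟩ := isInt_divDeriv_linear_mul (m := m) hkd (hg m)
  refine ⟨z, ?_⟩
  rw [← hz, mul_comm (2 : ℚ), mul_assoc, hkey]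

/-- **Théorème 1 from the integrality of the tail multiple sums.** If `gTailEven k N M B r` and `gTailOdd k N M B r`
are `IsDInt (d_{k+N})` at `0` to all orders for all `k ≥ 1`, `B ≥ 1`, `M`, `N`, `r` (the general-`k` analogue of
Proposition 6, i.e. the content of KR's brick decomposition (eq:dernier)), then Krattenthaler–Rivoal's Théorème 1
(the named fact `theoreme1`) holds. [cite: KrattenthalerRivoal2007, §13 Proposition 7 ⇒ Théorème 1 (ii); §3 Théorème 1] -/
theorem theoreme1_of_gTail_isDInt
    (hE : ∀ k N M B r : ℕ, 1 ≤ k → 1 ≤ B → ∀ N' : ℕ, IsDInt (Nat.lcmUpto (k + N)) N' (gTailEven k N M B r) 0)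
    (hO : ∀ k N M B r : ℕ, 1 ≤ k → 1 ≤ B → ∀ N' : ℕ, IsDInt (Nat.lcmUpto (k + N)) N' (gTailOdd k N M B r) 0) :
    theoreme1 := by
  refine theoreme1_of_prop7 fun n A B r hA hB c hc i hi1 hin e he1 heA => ?_
  obtain ⟨N, rfl⟩ : ∃ N, n = i + N := ⟨n - i, by omega⟩
  obtain ⟨M, hM | hM⟩ := Nat.even_or_odd' A
  · obtain ⟨M', rfl⟩ : ∃ M', A = 2 * M' + 2 := ⟨M - 1, by omega⟩
    exact prop7_even_of_isDInt i N M' B r hi1 (hE i N M' B r hi1 hB) c hc e he1 heA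
  · obtain ⟨M', rfl⟩ : ∃ M', A = 2 * M' + 3 := ⟨M - 1, by omega⟩
    exact prop7_odd_of_isDInt i N M' B r hi1 (hO i N M' B r hi1 hB) c hc e he1 heA

end Literature.NumberTheory.Irrationality.KrattenthalerRivoal2007
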